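import Mathlib
import Summits.ValiantsHypothesis.ValiantsHypothesis.Theorems.NewtonUnitEquationsNewtonTauWeakStubLeadingTermWronskian

/-! # Brick `stub_engineUniqueWords` — crux `TwoProducts` (stmt-ValiantsHypothesis-5906), line `corner-log-linearization`

UNIQUE WORDS ⇒ VERTICES ARE LETTERS (lead c8; pure support combinatorics).  For `u v : Fin n → ℂ[x,y]` with
constant terms `1`, a *word* is `d : Fin n → ℕ²` with `d i ∈ S i := supp u_i ∪ supp v_i` (so `0 ∈ S i`).  Expanding,
`∏ u_i = Σ_{d ∈ piFinset S} (∏ u_i[d_i]) · x^{Σ d_i}` (and likewise for `v`), so if distinct words have distinct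
sums (hypothesis UR) the coefficient of `∏ u − ∏ v` at the sum of a word `d` is `∏ u_i[d_i] − ∏ v_i[d_i]`, and it
vanishes at every point that is not a word sum.  Let `e` be a strict minimiser of a positive weight `w` on
`supp (∏ u − ∏ v)`, with word `d`.  If `d` had two distinct nonzero entries `d_j, d_k`, then for each of them the
single-entry word `Pi.single j d_j` has sum `d_j`, which is componentwise below `e` and strictly lighter, hence
outside the support, forcing `u_j[d_j] = v_j[d_j]`; so the vertex coefficient `∏ u_i[d_i] − ∏ v_i[d_i]` would
vanish.  Hence `d` has exactly one nonzero entry `d_j = e`: a letter of factor `j` with `u_j[e] ≠ v_j[e]`.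
[folklore] -/

set_option linter.dupNamespace false -- single-conjunct summit: `ValiantsHypothesis.ValiantsHypothesis`

namespace Summit.ValiantsHypothesis.ValiantsHypothesis.Theorems.TwoProducts.UniqueWords

open scoped BigOperators Classical

open MvPolynomial

/-- A polynomial is the sum of its monomials over any finite set containing its support. [folklore] -/
theorem uw_as_sum_subset {σ R : Type*} [CommSemiring R] (p : MvPolynomial σ R) (S : Finset (σ →₀ ℕ))
    (h : p.support ⊆ S) : p = ∑ a ∈ S, monomial a (coeff a p) :=
  calc p = ∑ a ∈ p.support, monomial a (coeff a p) := p.as_sum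
    _ = ∑ a ∈ S, monomial a (coeff a p) :=
        Finset.sum_subset h fun a _ ha => by rw [notMem_support_iff.mp ha, monomial_zero]

/-- Word expansion of a finite product of polynomials whose supports lie in prescribed finite sets: the product is
the sum over all words `d ∈ piFinset S` of the monomial at `∑ d_i` with coefficient `∏ p_i[d_i]`. [folklore] -/
theorem uw_prod_expand {n : ℕ} (p : Fin n → MvPolynomial (Fin 2) ℂ) (S : Fin n → Finset (Fin 2 →₀ ℕ))
    (h : ∀ i, (p i).support ⊆ S i) :
    ∏ i, p i = ∑ d ∈ Fintype.piFinset S, monomial (∑ i, d i) (∏ i, coeff (d i) (p i)) := by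
  have hp : ∏ i, p i = ∏ i, ∑ a ∈ S i, monomial a (coeff a (p i)) :=
    Finset.prod_congr rfl fun i _ => uw_as_sum_subset (p i) (S i) (h i)
  rw [hp, Finset.prod_univ_sum]
  -- `∏ monomial = monomial (∑) (∏)`: reused from the landed `NewtonTauWeak` leading-term brick
  exact Finset.sum_congr rfl fun d _ => NewtonUnitEquationsNewtonTauWeak.LeadingTerm.prod_monomial _ _ _

/-- Coefficient of a finite product at a point: the sum of `∏ p_i[d_i]` over the words `d` with exponent sum equal
to that point. [folklore] -/
theorem uw_coeff_prod {n : ℕ} (p : Fin n → MvPolynomial (Fin 2) ℂ) (S : Fin n → Finset (Fin 2 →₀ ℕ))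
    (h : ∀ i, (p i).support ⊆ S i) (e : Fin 2 →₀ ℕ) :
    coeff e (∏ i, p i) =
      ∑ d ∈ (Fintype.piFinset S).filter (fun d => ∑ i, d i = e), ∏ i, coeff (d i) (p i) := by
  rw [uw_prod_expand p S h, coeff_sum, Finset.sum_filter]
  exact Finset.sum_congr rfl fun d _ => coeff_monomial _ _ _

/-- Under unique readability (distinct words have distinct sums), the coefficient of the product at the sum of a
word is the product of its letter coefficients. [folklore] -/
theorem uw_coeff_prod_of_word {n : ℕ} (p : Fin n → MvPolynomial (Fin 2) ℂ) (S : Fin n → Finset (Fin 2 →₀ ℕ))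
    (h : ∀ i, (p i).support ⊆ S i)
    (hUR : ∀ d d' : Fin n → (Fin 2 →₀ ℕ), (∀ i, d i ∈ S i) → (∀ i, d' i ∈ S i) →
      ∑ i, d i = ∑ i, d' i → d = d')
    (d : Fin n → (Fin 2 →₀ ℕ)) (hd : ∀ i, d i ∈ S i) :
    coeff (∑ i, d i) (∏ i, p i) = ∏ i, coeff (d i) (p i) := by
  rw [uw_coeff_prod p S h]
  have hfib : (Fintype.piFinset S).filter (fun d' => ∑ i, d' i = ∑ i, d i) = {d} := by
    refine Finset.eq_singleton_iff_unique_mem.mpr ⟨?_, fun d' hd' => ?_⟩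
    · exact Finset.mem_filter.mpr ⟨Fintype.mem_piFinset.mpr hd, rfl⟩
    · obtain ⟨h1, h2⟩ := Finset.mem_filter.mp hd'
      exact hUR d' d (Fintype.mem_piFinset.mp h1) hd h2
  rw [hfib, Finset.sum_singleton]

/-- If the supports lie in the prescribed letter sets, the coefficient of the product vanishes at every point that
is not the sum of a word. [folklore] -/
theorem uw_coeff_prod_of_no_word {n : ℕ} (p : Fin n → MvPolynomial (Fin 2) ℂ) (S : Fin n → Finset (Fin 2 →₀ ℕ))
    (h : ∀ i, (p i).support ⊆ S i) (e : Fin 2 →₀ ℕ)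
    (he : ∀ d : Fin n → (Fin 2 →₀ ℕ), (∀ i, d i ∈ S i) → ∑ i, d i ≠ e) :
    coeff e (∏ i, p i) = 0 := by
  rw [uw_coeff_prod p S h]
  refine Finset.sum_eq_zero fun d hd => ?_
  obtain ⟨h1, h2⟩ := Finset.mem_filter.mp hd
  exact absurd h2 (he d (Fintype.mem_piFinset.mp h1))

/-- **Unique words ⇒ vertices are letters.**  Let `u v : Fin n → ℂ[x,y]` have constant terms `1`, and suppose
that words `d` with `d i ∈ supp u_i ∪ supp v_i` are determined by their sums (unique readability).  Then every
strict minimiser `e` of a positive integer weight on `supp (∏ u − ∏ v)` is nonzero and is a letter of some factor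
`i` at which the two sides disagree: `e ∈ supp u_i ∪ supp v_i` and `u_i[e] ≠ v_i[e]`. [folklore] -/
theorem stub_engineUniqueWords : ∀ (n : ℕ) (u v : Fin n → MvPolynomial (Fin 2) ℂ),
    (∀ i, MvPolynomial.coeff 0 (u i) = 1) → (∀ i, MvPolynomial.coeff 0 (v i) = 1) →
    (∀ d d' : Fin n → (Fin 2 →₀ ℕ), (∀ i, d i ∈ (u i).support ∪ (v i).support) →
      (∀ i, d' i ∈ (u i).support ∪ (v i).support) → ∑ i, d i = ∑ i, d' i → d = d') →
    ∀ (w : Fin 2 → ℤ), 0 < w 0 → 0 < w 1 → ∀ (e : Fin 2 →₀ ℕ),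
    (e ∈ (∏ i, u i - ∏ i, v i).support ∧ ∀ e' ∈ (∏ i, u i - ∏ i, v i).support, e' ≠ e →
      w 0 * (e 0 : ℤ) + w 1 * (e 1 : ℤ) < w 0 * (e' 0 : ℤ) + w 1 * (e' 1 : ℤ)) →
    e ≠ 0 ∧ ∃ i, (e ∈ (u i).support ∨ e ∈ (v i).support) ∧
      MvPolynomial.coeff e (u i) ≠ MvPolynomial.coeff e (v i) := by
  intro n u v hu hv hUR w hw0 hw1 e he
  obtain ⟨he, hmin⟩ := he
  -- the letter sets `S i = supp u_i ∪ supp v_i`; they contain `0`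
  set S : Fin n → Finset (Fin 2 →₀ ℕ) := fun i => (u i).support ∪ (v i).support with hS
  have hSu : ∀ i, (u i).support ⊆ S i := fun i => Finset.subset_union_left
  have hSv : ∀ i, (v i).support ⊆ S i := fun i => Finset.subset_union_right
  have h0S : ∀ i, (0 : Fin 2 →₀ ℕ) ∈ S i := fun i =>
    Finset.mem_union_left _ (mem_support_iff.mpr (by rw [hu i]; exact one_ne_zero))
  -- coefficient of the difference at the sum of a word
  have hword : ∀ d : Fin n → (Fin 2 →₀ ℕ), (∀ i, d i ∈ S i) →
      coeff (∑ i, d i) (∏ i, u i - ∏ i, v i) = ∏ i, coeff (d i) (u i) - ∏ i, coeff (d i) (v i) := by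
    intro d hd
    rw [coeff_sub, uw_coeff_prod_of_word u S hSu hUR d hd, uw_coeff_prod_of_word v S hSv hUR d hd]
  -- the word `d` of the vertex `e`
  obtain ⟨d, hd, hde⟩ : ∃ d : Fin n → (Fin 2 →₀ ℕ), (∀ i, d i ∈ S i) ∧ ∑ i, d i = e := by
    by_contra hne
    push Not at hne
    refine mem_support_iff.mp he ?_
    rw [coeff_sub, uw_coeff_prod_of_no_word u S hSu e hne, uw_coeff_prod_of_no_word v S hSv e hne, sub_zero]
  have hm : ∏ i, coeff (d i) (u i) - ∏ i, coeff (d i) (v i) ≠ 0 := by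
    rw [← hword d hd, hde]
    exact mem_support_iff.mp he
  -- some entry of the word is nonzero
  obtain ⟨j, hj⟩ : ∃ j, d j ≠ 0 := by
    by_contra hall
    push Not at hall
    exact hm (by simp [hall, hu, hv])
  -- key step: if another entry `d k` (`k ≠ i`) is nonzero, then the two sides agree at the letter `d i`
  have hkey : ∀ i k : Fin n, k ≠ i → d k ≠ 0 → coeff (d i) (u i) = coeff (d i) (v i) := by
    intro i k hki hk
    -- the single-entry word `Pi.single i (d i)` and its sum `d i`
    have hsS : ∀ l, (Pi.single i (d i) : Fin n → (Fin 2 →₀ ℕ)) l ∈ S l := by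
      intro l
      rcases eq_or_ne l i with rfl | hl
      · rw [Pi.single_eq_same]; exact hd l
      · rw [Pi.single_eq_of_ne hl]; exact h0S l
    have hsum : ∑ l, (Pi.single i (d i) : Fin n → (Fin 2 →₀ ℕ)) l = d i := by
      rw [Fintype.sum_eq_single i ?_, Pi.single_eq_same]
      exact fun l hl => Pi.single_eq_of_ne hl _
    have hpu : ∏ l, coeff ((Pi.single i (d i) : Fin n → (Fin 2 →₀ ℕ)) l) (u l) = coeff (d i) (u i) := by
      rw [Fintype.prod_eq_single i ?_, Pi.single_eq_same]
      intro l hl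
      rw [Pi.single_eq_of_ne hl, hu]
    have hpv : ∏ l, coeff ((Pi.single i (d i) : Fin n → (Fin 2 →₀ ℕ)) l) (v l) = coeff (d i) (v i) := by
      rw [Fintype.prod_eq_single i ?_, Pi.single_eq_same]
      intro l hl
      rw [Pi.single_eq_of_ne hl, hv]
    have hcoef : coeff (d i) (∏ l, u l - ∏ l, v l) = coeff (d i) (u i) - coeff (d i) (v i) := by
      have h := hword _ hsS
      rw [hsum, hpu, hpv] at h
      exact h
    -- `d i + d k ≤ e` componentwise, and `d k ≠ 0`, so `d i` is strictly lighter than `e`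
    have hcoord : ∀ c : Fin 2, d i c + d k c ≤ e c := by
      intro c
      have h2 : d i c + d k c = ∑ l ∈ ({i, k} : Finset (Fin n)), d l c :=
        (Finset.sum_pair (f := fun l => d l c) hki.symm).symm
      rw [← hde, Finsupp.finsetSum_apply, h2]
      exact Finset.sum_le_univ_sum_of_nonneg fun l => Nat.zero_le _
    have hk' : 0 < d k 0 ∨ 0 < d k 1 := by
      have h2 := Fin.exists_fin_two.mp (DFunLike.ne_iff.mp hk)
      simp only [Finsupp.coe_zero, Pi.zero_apply] at h2
      exact h2.imp Nat.pos_of_ne_zero Nat.pos_of_ne_zero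
    have h0 := hcoord 0
    have h1 := hcoord 1
    have hne : d i ≠ e := by
      intro heq
      rw [heq] at h0 h1
      rcases hk' with h | h <;> omega
    -- hence `d i` is not in the support (it would beat the strict minimiser `e`)
    have hnot : d i ∉ (∏ l, u l - ∏ l, v l).support := by
      intro hmem
      have hlt := hmin (d i) hmem hne
      have hA : w 0 * ((d i 0 : ℕ) : ℤ) + w 0 * ((d k 0 : ℕ) : ℤ) ≤ w 0 * ((e 0 : ℕ) : ℤ) := by
        rw [← mul_add]; exact mul_le_mul_of_nonneg_left (by exact_mod_cast h0) hw0.le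
      have hB : w 1 * ((d i 1 : ℕ) : ℤ) + w 1 * ((d k 1 : ℕ) : ℤ) ≤ w 1 * ((e 1 : ℕ) : ℤ) := by
        rw [← mul_add]; exact mul_le_mul_of_nonneg_left (by exact_mod_cast h1) hw1.le
      have hC : 0 ≤ w 0 * ((d k 0 : ℕ) : ℤ) := mul_nonneg hw0.le (by positivity)
      have hD : 0 ≤ w 1 * ((d k 1 : ℕ) : ℤ) := mul_nonneg hw1.le (by positivity)
      rcases hk' with h | h
      · have hC' : 0 < w 0 * ((d k 0 : ℕ) : ℤ) := mul_pos hw0 (by exact_mod_cast h)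
        linarith
      · have hD' : 0 < w 1 * ((d k 1 : ℕ) : ℤ) := mul_pos hw1 (by exact_mod_cast h)
        linarith
    have h00 := notMem_support_iff.mp hnot
    rw [hcoef] at h00
    exact sub_eq_zero.mp h00
  -- conclusion: the word `d` has exactly one nonzero entry `d j = e`
  by_cases hex : ∃ k, k ≠ j ∧ d k ≠ 0
  · obtain ⟨k, hkj, hk⟩ := hex
    exfalso
    refine hm (sub_eq_zero.mpr (Finset.prod_congr rfl fun i _ => ?_))
    rcases eq_or_ne i j with rfl | hij
    · exact hkey i k hkj hk
    · exact hkey i j hij.symm hj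
  · push Not at hex
    have hsumj : ∑ l, d l = d j := Fintype.sum_eq_single j fun l hl => hex l hl
    rw [hsumj] at hde
    subst hde
    refine ⟨hj, j, Finset.mem_union.mp (hd j), ?_⟩
    have hpu : ∏ i, coeff (d i) (u i) = coeff (d j) (u j) := by
      rw [Fintype.prod_eq_single j ?_]
      exact fun l hl => by rw [hex l hl, hu]
    have hpv : ∏ i, coeff (d i) (v i) = coeff (d j) (v j) := by
      rw [Fintype.prod_eq_single j ?_]
      exact fun l hl => by rw [hex l hl, hv]
    rw [hpu, hpv] at hm
    exact sub_ne_zero.mp hm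

end Summit.ValiantsHypothesis.ValiantsHypothesis.Theorems.TwoProducts.UniqueWords
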